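import Summits.BirchSwinnertonDyer.BirchSwinnertonDyer.Theses.BiquadraticEisensteinDescent
import Literature.NumberTheory.EllipticCurves.DeuringSupersingularReductionHoldsProofs
import HarnessLib

/-!
# Route BiquadraticEisensteinDescent — glue item `PublishedInputsBiquadraticOfParts` (stmt-BirchSwinnertonDyer-20324)

The support `PublishedInputsBiquadratic` (stmt-BirchSwinnertonDyer-20243, the conjunction of the eleven published
inputs consumed by `closes`) was SPLIT (gen 1) into eight by-name children plus this glue
`PublishedInputsBiquadraticOfParts := ClassicalInputsBiquadratic → RankEqAnalyticRankLeOne → EntireLFunctionRat →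
NewformOfEllipticCurve → FriedbergHoffsteinHeegnerSplitTwist → CMRankZeroBSDTriple → EdixhovenManinNonPotOrdinary →
BSDQuotientIsogenyInvariance → PublishedInputsBiquadratic`. Conjuncts 1–3 are the three conjuncts of
`ClassicalInputsBiquadratic`, conjuncts 4–9 and 11 are the other seven children verbatim, and conjunct 10 (Deuring's
criterion, supersingular half) is the tree THEOREM
`Literature.NumberTheory.EllipticCurves.deuring_not_hasUnitRootAt_of_hasCM_of_not_cmSplit_holds` — so the glue is
pure logic plus that one name.

HONEST FRAMING: THEOREMS ONLY (0 definitions, 0 named facts, 0 `sorry`); proving the glue asserts nothing about the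
children. Prover seat bsd-wall-bed-p2 (g4), 2026-08-27.
-/

set_option autoImplicit false

-- D-0017 layout: summit = sub-problem, so `Summit.BirchSwinnertonDyer.BirchSwinnertonDyer.…` is the mandated namespace.
set_option linter.dupNamespace false

namespace Summit.BirchSwinnertonDyer.BirchSwinnertonDyer.Theorems.BiquadraticEisensteinDescentPublishedInputsBiquadraticOfParts

/-- **Glue of the split support `PublishedInputsBiquadratic` (item stmt-BirchSwinnertonDyer-20324).** The eight
by-name children `ClassicalInputsBiquadratic` (Gross–Zagier, Kolyvagin, Matar–Nekovář Thm 0.3), `RankEqAnalyticRankLeOne`,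
`EntireLFunctionRat`, `NewformOfEllipticCurve`, `FriedbergHoffsteinHeegnerSplitTwist`, `CMRankZeroBSDTriple`,
`EdixhovenManinNonPotOrdinary`, `BSDQuotientIsogenyInvariance` imply the eleven-conjunct parent; the one conjunct that
is no child — Deuring's criterion `deuring_not_hasUnitRootAt_of_hasCM_of_not_cmSplit` — is discharged in the tree by
`Literature.NumberTheory.EllipticCurves.deuring_not_hasUnitRootAt_of_hasCM_of_not_cmSplit_holds`
[cite: Lang1987, Ch. 13 §4 Thm. 12]. -/
theorem publishedInputsBiquadraticOfParts_proof :
    Summit.BirchSwinnertonDyer.BirchSwinnertonDyer.Theses.BiquadraticEisensteinDescent.PublishedInputsBiquadraticOfParts := by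
  unfold Summit.BirchSwinnertonDyer.BirchSwinnertonDyer.Theses.BiquadraticEisensteinDescent.PublishedInputsBiquadraticOfParts
  intro h1 h2 h3 h4 h5 h6 h7 h8
  exact ⟨h1.1, h1.2.1, h1.2.2, h2, h3, h4, h5, h6, h7,
    Literature.NumberTheory.EllipticCurves.deuring_not_hasUnitRootAt_of_hasCM_of_not_cmSplit_holds, h8⟩

end Summit.BirchSwinnertonDyer.BirchSwinnertonDyer.Theorems.BiquadraticEisensteinDescentPublishedInputsBiquadraticOfParts
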